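import Summits.BirchSwinnertonDyer.BirchSwinnertonDyer.Theorems.PrintCf2RubinValueTwoLeopoldtTowerLayersAbelian
import Literature.NumberTheory.EllipticCurves.ComplexMultiplicationDeuringGaloisAction
import Literature.NumberTheory.EllipticCurves.DivisionField
import HarnessLib

/-!
# The `p`-power division fields `K(E[p^k])` of a CM curve are ABELIAN over `K` (split `p`, maximal order),
# from the cited Deuring split print — the CM-abelianity input of the division-tower packages

Cell `bsd-print-cf2`, width seat `bsd-line-cf2-p1-w8` g6; crux of record `stmt-BirchSwinnertonDyer-24721`
(m_line_pin (Q)/(T); division-tower packages `hGdiv`/`hNdiv` of cf2c-w2 g8 14:59:42Z and -w7 g8 15:05:42Z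
«BOTH need `IsAbelianGalois K ((W.baseChange K).divisionField m)` (CM division fields abelian /K, Silverman
Adv. II Thm 2.3), which is NOT in the tree»).  `--supports` 24721; Theses-free; THEOREMS ONLY (no
definition, no named fact, no `sorry`).

* §1 (pure group theory + Galois theory; any number field `K`, any elliptic `W/K`, any prime `p`)
  `exists_int_forall_smul_eq_of_cyclic_layer` (scalar form: `σ` acts on a stable cyclic layer by ONE integer),
  `smul_smul_comm_of_cyclic_stable_components` — if `E[p^∞] = M₁ + M₂` with `M₁, M₂ ≤ E[p^∞]` both
  `Γ_K`-stable and with every layer `Mᵢ[p^j]` CYCLIC (`Mᵢ ⊓ E[p^∞][p^j] = ℤ·g`), then any two `σ, τ ∈ Γ_K`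
  COMMUTE on `E[p^∞]` (each acts on the stable cyclic layer `ℤ·g ∋ σg` by an integer scalar);
  ★ `isAbelianGalois_divisionField_of_cyclic_stable_components` — hence the commutators of `Γ_K` fix
  `E[p^k] ⊆ E[p^∞]`, i.e. lie in `Γ_{K(E[p^k])}`, and **`K(E[p^k])/K` is abelian** (`IsAbelianGalois`, via
  cf2c-w5's `LeopoldtAtV.isAbelianGalois_fixedField_of_commutator_mem`; `K(E[n])` is the fixed field of
  `fixingSubgroupOfModule K E[n]` by definition, `WeierstrassCurve.divisionField`).
* §2 ★ `isAbelianGalois_baseChange_divisionField_pow_of_deuring` — for `E/ℚ` with CM by the maximal order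
  of `K` (`W.j ∈ maximalCMJInvariants`, `IsCMFieldOfJ K W.j`), its Grössencharacter frame `(c, ψ)` and a prime
  `p = v·v̄` SPLIT in `K`: granted the cited print `Deuring_galoisAction_cmPrimaryTorsion_split` (Rubin LNM 1716
  §5 Prop. 5.4 / Cor. 5.5: `E[p^∞] = E[v^∞] ⊕ E[v̄^∞]`, each `Γ_K`-stable with cyclic layers),
  **`IsAbelianGalois K ((W.baseChange K).divisionField (p ^ k))` for every `k`**; `p = 2` reading
  `isAbelianGalois_baseChange_divisionField_two_pow_of_deuring` (the towers `K(E[4·2ⁿ]) = K(E[2^{n+2}])` of the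
  (Q)/(T) packages over `K = ℚ(√−7)`).

Not here: general `m` (non-`p`-power), non-split `p`, non-maximal orders (Silverman *ATAEC* II Thm. 2.3 in
full); -w7 g8's `towerGaloisHyps_of_isAbelianGalois`.  HONEST FRAMING: conditional on a cited print already
carried by the crux's cite stub `stub_prints_rubin_two`; closes nothing by itself; beyond-print theorem: no.
No summit statement is proved by this seat; BSD is not proved by any of this.

## References
* [Rubin1999] K. Rubin, *Elliptic curves with complex multiplication and the conjecture of Birch and
  Swinnerton-Dyer*, LNM 1716 (1999), §5 Prop. 5.4, Cor. 5.5, (7).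
* [SilvermanATAEC1994] J. H. Silverman, *Advanced Topics in the Arithmetic of Elliptic Curves* (1994),
  Ch. II Thm. 2.3 (`K(E_tors)` is abelian over the CM field).
* [SilvermanAEC2009] J. H. Silverman, *The Arithmetic of Elliptic Curves* (2009), VIII.§1.
-/

-- the summit namespace `Summit.BirchSwinnertonDyer.BirchSwinnertonDyer` repeats the problem name by design (D-0017)
set_option linter.dupNamespace false
set_option autoImplicit false

noncomputable section

open scoped Classical

open Field NumberField IsDedekindDomain WeierstrassCurve Literature.NumberTheory.EllipticCurves
  Literature.NumberTheory.GaloisRepresentations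

namespace Summit.BirchSwinnertonDyer.BirchSwinnertonDyer.Theorems.PrintCf2.CMDivisionFieldAbelian

/-! ## §1. Two stable cyclic-layered components force commuting Galois action -/

section Abstract

variable {K : Type} [Field K] (W : WeierstrassCurve K) (p : ℕ)

/-- **Scalar form (the interface -w7 g8 asked for): on a `Γ_K`-stable subgroup `M ≤ E[p^∞]` whose
`p^j`-layer is cyclic (`M ⊓ E[p^∞][p^j] = ℤ·g`), every `σ ∈ Γ_K` acts on that layer as ONE integer scalar:
`∃ a : ℤ, ∀ x ∈ M ⊓ E[p^∞][p^j], σ • x = a • x`** (`σg` lies in the stable layer `ℤ·g`).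
[cite: Rubin1999, §5 Prop. 5.4, Cor. 5.5] -/
theorem exists_int_forall_smul_eq_of_cyclic_layer {M : AddSubgroup (geomPrimaryTorsion W p)}
    (hst : ∀ σ : absoluteGaloisGroup K, ∀ x ∈ M, σ • x ∈ M) {j : ℕ} {g : geomPrimaryTorsion W p}
    (hg : M ⊓ AddSubgroup.torsionBy (geomPrimaryTorsion W p) (p ^ j) = AddSubgroup.zmultiples g)
    (σ : absoluteGaloisGroup K) :
    ∃ a : ℤ, ∀ x ∈ M ⊓ AddSubgroup.torsionBy (geomPrimaryTorsion W p) (p ^ j), σ • x = a • x := by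
  -- `g` itself lies in the layer, hence in `M` and is killed by `p^j`
  have hgmem : g ∈ M ⊓ AddSubgroup.torsionBy (geomPrimaryTorsion W p) (p ^ j) :=
    hg ▸ AddSubgroup.mem_zmultiples g
  obtain ⟨hgM, hgtor⟩ := AddSubgroup.mem_inf.mp hgmem
  have hσg : σ • g ∈ M ⊓ AddSubgroup.torsionBy (geomPrimaryTorsion W p) (p ^ j) := by
    refine AddSubgroup.mem_inf.mpr ⟨hst σ g hgM, ?_⟩
    have htor : ((p : ℤ) ^ j) • g = 0 := by simpa using hgtor
    show ((p ^ j : ℕ) : ℤ) • (σ • g) = 0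
    rw [Nat.cast_pow, smul_comm, htor, smul_zero]
  rw [hg, AddSubgroup.mem_zmultiples_iff] at hσg
  obtain ⟨a, ha⟩ := hσg
  refine ⟨a, fun x hx ↦ ?_⟩
  rw [hg, AddSubgroup.mem_zmultiples_iff] at hx
  obtain ⟨c, rfl⟩ := hx
  rw [smul_comm σ c g, ← ha, smul_comm c a g]

/-- **`Γ_K` acts on a stable subgroup with cyclic `p^j`-layers through commuting scalars.**  If `M ≤ E[p^∞]`
is `Γ_K`-stable and `M ⊓ E[p^∞][p^j] = ℤ·g`, then for `x ∈ ℤ·g`: `σ • τ • x = τ • σ • x` (both `σg`, `τg` lie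
in the stable cyclic layer `ℤ·g`, so `σ`, `τ` act on it as integer scalars). [cite: Rubin1999, §5 Prop. 5.4, Cor. 5.5] -/
theorem smul_smul_comm_of_mem_zmultiples {M : AddSubgroup (geomPrimaryTorsion W p)}
    (hst : ∀ σ : absoluteGaloisGroup K, ∀ x ∈ M, σ • x ∈ M) {j : ℕ} {g : geomPrimaryTorsion W p}
    (hg : M ⊓ AddSubgroup.torsionBy (geomPrimaryTorsion W p) (p ^ j) = AddSubgroup.zmultiples g)
    (σ τ : absoluteGaloisGroup K) {x : geomPrimaryTorsion W p} (hx : x ∈ AddSubgroup.zmultiples g) :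
    σ • τ • x = τ • σ • x := by
  -- `g` itself lies in the layer, hence in `M` and is killed by `p^j`
  have hgmem : g ∈ M ⊓ AddSubgroup.torsionBy (geomPrimaryTorsion W p) (p ^ j) :=
    hg ▸ AddSubgroup.mem_zmultiples g
  obtain ⟨hgM, hgtor⟩ := AddSubgroup.mem_inf.mp hgmem
  -- every Galois translate of `g` is an integer multiple of `g`
  have hscalar : ∀ ρ : absoluteGaloisGroup K, ∃ a : ℤ, ρ • g = a • g := by
    intro ρ
    have hρg : ρ • g ∈ M ⊓ AddSubgroup.torsionBy (geomPrimaryTorsion W p) (p ^ j) := by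
      refine AddSubgroup.mem_inf.mpr ⟨hst ρ g hgM, ?_⟩
      have htor : ((p : ℤ) ^ j) • g = 0 := by simpa using hgtor
      show ((p ^ j : ℕ) : ℤ) • (ρ • g) = 0
      rw [Nat.cast_pow, smul_comm, htor, smul_zero]
    rw [hg, AddSubgroup.mem_zmultiples_iff] at hρg
    obtain ⟨a, ha⟩ := hρg
    exact ⟨a, ha.symm⟩
  obtain ⟨c, rfl⟩ := AddSubgroup.mem_zmultiples_iff.mp hx
  obtain ⟨a, ha⟩ := hscalar σ
  obtain ⟨b, hb⟩ := hscalar τ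
  have h1 : σ • τ • c • g = (c * b * a) • g := by
    rw [smul_comm τ c g, hb, smul_comm σ c (b • g), smul_comm σ b g, ha, smul_smul, smul_smul]
  have h2 : τ • σ • c • g = (c * a * b) • g := by
    rw [smul_comm σ c g, ha, smul_comm τ c (a • g), smul_comm τ a g, hb, smul_smul, smul_smul]
  rw [h1, h2, mul_right_comm]

/-- **Two `Γ_K`-stable components with cyclic layers spanning `E[p^∞]` make the `Γ_K`-action on `E[p^∞]`
commutative**: `σ • τ • P = τ • σ • P` for all `P ∈ E[p^∞]`.  (`P = x₁ + x₂`, `xᵢ ∈ Mᵢ`; `xᵢ` is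
`p^j`-torsion for some `j`, so it lies in the cyclic layer `Mᵢ ⊓ E[p^∞][p^j] = ℤ·gᵢ`.)
[cite: Rubin1999, §5 Prop. 5.4, Cor. 5.5, (7)] -/
theorem smul_smul_comm_of_cyclic_stable_components (M₁ M₂ : AddSubgroup (geomPrimaryTorsion W p))
    (hsup : M₁ ⊔ M₂ = ⊤)
    (hst₁ : ∀ σ : absoluteGaloisGroup K, ∀ x ∈ M₁, σ • x ∈ M₁)
    (hst₂ : ∀ σ : absoluteGaloisGroup K, ∀ x ∈ M₂, σ • x ∈ M₂)
    (hcyc₁ : ∀ j : ℕ, ∃ g ∈ M₁, M₁ ⊓ AddSubgroup.torsionBy (geomPrimaryTorsion W p) (p ^ j) = AddSubgroup.zmultiples g)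
    (hcyc₂ : ∀ j : ℕ, ∃ g ∈ M₂, M₂ ⊓ AddSubgroup.torsionBy (geomPrimaryTorsion W p) (p ^ j) = AddSubgroup.zmultiples g)
    (σ τ : absoluteGaloisGroup K) (P : geomPrimaryTorsion W p) : σ • τ • P = τ • σ • P := by
  -- every element of `E[p^∞]` is killed by some `p^j`
  have htor : ∀ x : geomPrimaryTorsion W p, ∃ j : ℕ,
      x ∈ AddSubgroup.torsionBy (geomPrimaryTorsion W p) (p ^ j) := by
    intro x
    obtain ⟨j, hj⟩ := x.2
    refine ⟨j, ?_⟩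
    have h0 : (p ^ j) • x = 0 := Subtype.ext (by rw [AddSubgroupClass.coe_nsmul, ZeroMemClass.coe_zero]; exact hj)
    show ((p ^ j : ℕ) : ℤ) • x = 0
    rw [natCast_zsmul, h0]
  -- the layer decomposition
  have hlayer : ∀ {M : AddSubgroup (geomPrimaryTorsion W p)},
      (∀ σ : absoluteGaloisGroup K, ∀ x ∈ M, σ • x ∈ M) →
      (∀ j : ℕ, ∃ g ∈ M, M ⊓ AddSubgroup.torsionBy (geomPrimaryTorsion W p) (p ^ j) = AddSubgroup.zmultiples g) →
      ∀ x ∈ M, σ • τ • x = τ • σ • x := by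
    intro M hst hcyc x hx
    obtain ⟨j, hj⟩ := htor x
    obtain ⟨g, -, hg⟩ := hcyc j
    have hxg : x ∈ AddSubgroup.zmultiples g := hg ▸ AddSubgroup.mem_inf.mpr ⟨hx, hj⟩
    exact smul_smul_comm_of_mem_zmultiples W p hst hg σ τ hxg
  have hP : P ∈ M₁ ⊔ M₂ := hsup ▸ AddSubgroup.mem_top P
  obtain ⟨x₁, hx₁, x₂, hx₂, rfl⟩ := AddSubgroup.mem_sup.mp hP
  rw [smul_add, smul_add, smul_add, smul_add, hlayer hst₁ hcyc₁ x₁ hx₁, hlayer hst₂ hcyc₂ x₂ hx₂]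

variable [NumberField K]

/-- ★ **`K(E[p^k])/K` is ABELIAN when `E[p^∞]` is spanned by two `Γ_K`-stable components with cyclic layers**
(`E/K` elliptic over a number field, any prime `p`, any `k`): the commutators of `Γ_K` act trivially on
`E[p^∞] ⊇ E[p^k]`, so they lie in `Γ_{K(E[p^k])} = fixingSubgroupOfModule K E[p^k]`, whose fixed field
`K(E[p^k])` (`WeierstrassCurve.divisionField`) is therefore an abelian Galois extension
(`LeopoldtAtV.isAbelianGalois_fixedField_of_commutator_mem`).
[cite: Rubin1999, §5 Prop. 5.4, Cor. 5.5, (7)] [cite: SilvermanATAEC1994, Ch. II Thm. 2.3] -/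
theorem isAbelianGalois_divisionField_of_cyclic_stable_components [W.IsElliptic]
    (M₁ M₂ : AddSubgroup (geomPrimaryTorsion W p)) (hsup : M₁ ⊔ M₂ = ⊤)
    (hst₁ : ∀ σ : absoluteGaloisGroup K, ∀ x ∈ M₁, σ • x ∈ M₁)
    (hst₂ : ∀ σ : absoluteGaloisGroup K, ∀ x ∈ M₂, σ • x ∈ M₂)
    (hcyc₁ : ∀ j : ℕ, ∃ g ∈ M₁, M₁ ⊓ AddSubgroup.torsionBy (geomPrimaryTorsion W p) (p ^ j) = AddSubgroup.zmultiples g)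
    (hcyc₂ : ∀ j : ℕ, ∃ g ∈ M₂, M₂ ⊓ AddSubgroup.torsionBy (geomPrimaryTorsion W p) (p ^ j) = AddSubgroup.zmultiples g)
    (k : ℕ) : IsAbelianGalois K (W.divisionField (p ^ k)) := by
  haveI : IsGalois K (AlgebraicClosure K) := {}
  -- commutators of `Γ_K` fix `E[p^k]`
  have key : ∀ σ τ : absoluteGaloisGroup K,
      σ * τ * σ⁻¹ * τ⁻¹ ∈ fixingSubgroupOfModule K (geomTorsion W ((p ^ k : ℕ) : ℤ)) := by
    intro σ τ
    rw [W.mem_fixingSubgroupOfModule_geomTorsion_iff]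
    intro T
    -- read `T ∈ E[p^k]` inside `E[p^∞]` and use the commutativity there
    have hT : ((T : geomPoints W)) ∈ geomPrimaryTorsion W p := by
      have hTk : ((p ^ k : ℕ) : ℤ) • (T : geomPoints W) = 0 := T.2
      rw [natCast_zsmul] at hTk
      exact ⟨k, hTk⟩
    have hc : ∀ a b : absoluteGaloisGroup K, a • b • (T : geomPoints W) = b • a • (T : geomPoints W) := by
      intro a b
      simpa only [primaryComponent.coe_smul] using congrArg (fun P : geomPrimaryTorsion W p ↦ (P : geomPoints W))
        (smul_smul_comm_of_cyclic_stable_components W p M₁ M₂ hsup hst₁ hst₂ hcyc₁ hcyc₂ a b ⟨(T : geomPoints W), hT⟩)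
    apply Subtype.ext
    rw [AddSubgroup.torsionBy.coe_smul, mul_smul, mul_smul, mul_smul, hc σ⁻¹ τ⁻¹, smul_inv_smul, smul_inv_smul]
  rw [divisionField_def]
  exact @LeopoldtAtV.isAbelianGalois_fixedField_of_commutator_mem K _ _
    (fixingSubgroupOfModule K (geomTorsion W ((p ^ k : ℕ) : ℤ))) (W.fixingSubgroupOfModule_geomTorsion_normal (p ^ k))
    fun σ τ ↦ key ((absoluteGaloisGroup.toAlgEquiv K).symm σ) ((absoluteGaloisGroup.toAlgEquiv K).symm τ)

end Abstract

/-! ## §2. CM curves with CM by the maximal order, split prime: from the Deuring split print -/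

section Deuring

/-- ★ **The `p`-power division fields of a CM curve are abelian over the CM field at a SPLIT prime, granted the
cited Deuring split print.**  `E/ℚ` (globally minimal `W`) with CM by the maximal order of `K`
(`W.j ∈ maximalCMJInvariants`, `IsCMFieldOfJ K W.j`), its frame `(c, ψ)` (complex conjugation `c ≠ 1`,
Grössencharacter `ψ` of type `(1,0)`, `c`-equivariant, `L(ψ, s) = L(E, s)`), `p = v·v̄` split (`v̄ ≠ v` above
`p`): then **`IsAbelianGalois K ((W.baseChange K).divisionField (p ^ k))`** for every `k` — by §1 applied to
the print's components `E[v^∞]`, `E[v̄^∞]` (`Γ_K`-stable, cyclic layers, `E[v^∞] ⊔ E[v̄^∞] = E[p^∞]`).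
[cite: Rubin1999, §5 Prop. 5.4, Cor. 5.5, (7)] [cite: SilvermanATAEC1994, Ch. II Thm. 2.3] -/
theorem isAbelianGalois_baseChange_divisionField_pow_of_deuring
    (hDG : Deuring_galoisAction_cmPrimaryTorsion_split)
    (W : WeierstrassCurve ℚ) [W.IsElliptic] [W.IsGloballyMinimal] (hj : W.j ∈ maximalCMJInvariants)
    (K : Type) [Field K] [NumberField K] (hK : IsCMFieldOfJ K W.j) (c : K ≃ₐ[ℚ] K) (hc : c ≠ 1)
    (ψ : HeckeCharacter K) (hψ : ψ.HasInfinityType (fun _ ↦ 1) (fun _ ↦ 0)) (hψc : IsHeckeConjEquivariant c ψ)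
    (hL : ∀ s : ℂ, 3 / 2 < s.re → heckeLFunction ψ s = W.LSeries s)
    (p : ℕ) [Fact p.Prime] (v vbar : HeightOneSpectrum (𝓞 K))
    (hv : ((p : ℕ) : 𝓞 K) ∈ v.asIdeal) (hvbar : ((p : ℕ) : 𝓞 K) ∈ vbar.asIdeal) (hne : vbar ≠ v) (k : ℕ) :
    IsAbelianGalois K ((W.baseChange K).divisionField (p ^ k)) := by
  haveI : (W.baseChange K).IsElliptic := by infer_instance
  obtain ⟨M, _, hsup, h₁, h₂⟩ := hDG W hj K hK c hc ψ hψ hψc hL p v vbar hv hvbar hne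
  exact isAbelianGalois_divisionField_of_cyclic_stable_components (W.baseChange K) p (M v) (M vbar) hsup
    h₁.smul_mem h₂.smul_mem (fun j ↦ by obtain ⟨g, hg, -, hg'⟩ := h₁.exists_generator j; exact ⟨g, hg, hg'⟩)
    (fun j ↦ by obtain ⟨g, hg, -, hg'⟩ := h₂.exists_generator j; exact ⟨g, hg, hg'⟩) k

/-- **`p = 2` reading for the division towers `K(E[2^{n}])` of the (Q)/(T) packages** (`K = ℚ(√−7)`,
`2 = v·v̄` split): `IsAbelianGalois K ((W.baseChange K).divisionField (2 ^ n))`, granted the Deuring split print.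
[cite: Rubin1999, §5 Prop. 5.4, Cor. 5.5, (7)] [cite: SilvermanATAEC1994, Ch. II Thm. 2.3] -/
theorem isAbelianGalois_baseChange_divisionField_two_pow_of_deuring
    (hDG : Deuring_galoisAction_cmPrimaryTorsion_split)
    (W : WeierstrassCurve ℚ) [W.IsElliptic] [W.IsGloballyMinimal] (hj : W.j ∈ maximalCMJInvariants)
    (K : Type) [Field K] [NumberField K] (hK : IsCMFieldOfJ K W.j) (c : K ≃ₐ[ℚ] K) (hc : c ≠ 1)
    (ψ : HeckeCharacter K) (hψ : ψ.HasInfinityType (fun _ ↦ 1) (fun _ ↦ 0)) (hψc : IsHeckeConjEquivariant c ψ)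
    (hL : ∀ s : ℂ, 3 / 2 < s.re → heckeLFunction ψ s = W.LSeries s)
    (v vbar : HeightOneSpectrum (𝓞 K))
    (hv : ((2 : ℕ) : 𝓞 K) ∈ v.asIdeal) (hvbar : ((2 : ℕ) : 𝓞 K) ∈ vbar.asIdeal) (hne : vbar ≠ v) (n : ℕ) :
    IsAbelianGalois K ((W.baseChange K).divisionField (2 ^ n)) :=
  haveI : Fact (Nat.Prime 2) := ⟨Nat.prime_two⟩
  isAbelianGalois_baseChange_divisionField_pow_of_deuring hDG W hj K hK c hc ψ hψ hψc hL 2 v vbar hv hvbar hne n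

end Deuring

end Summit.BirchSwinnertonDyer.BirchSwinnertonDyer.Theorems.PrintCf2.CMDivisionFieldAbelian
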